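import Summits.QuantumFields.YangMills.Theorems.BalabanLadderIRTwistedSlabGauge
import Literature.MathematicalPhysics.QuantumLattice.TwistedAdjointLaplacianGap
import HarnessLib

/-!
# Background-covariant lattice calculus on the `Fin` box: adjoint covariant shifts, their adjoints, and their commutation at a
# phase-flat background

HELPER toward stub **T1** `TwistedSlabAnchor` (LINE `twisted-slab-continuity`, crux `IRcof` stmt-QuantumFields-26930, census row 43;
LEAD prover ym-ir-line-tsc-p1 g3; `--supports` the crux, `--as helper`).  First file of the HOME HANDOFF item K3 («transversal
non-degeneracy of the classical vacua IN T1's OWN CURRENCY»): the operator calculus on the `FinTorusSite`-indexed box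
`n₀ × n₁ × n₂ × n₃` of `wilsonFinTorusTensorTwistedPartition`, for matrix-valued site fields `Φ : FinTorusSite → M_N(ℂ)` and an
arbitrary UNITARY background link field `U : FinTorusSite × Fin 4 → M_N(ℂ)`:
* §1 the polarised Hilbert–Schmidt pairing `Re tr(XᴴY)` (symmetry, bilinear expansions, `Ad`-invariance);
* §2 the periodic shift `x ↦ x + e_μ` as a BIJECTION of the sites (`siteUnshift`, `shiftEquiv`) — summation by parts on the
  `Fin` torus is reindexing along it (`sum_shift`, `sum_unshift`), with no window/periodicity bookkeeping;
* §3 the ADJOINT COVARIANT SHIFT `covShift U μ Φ (x) = U(x,μ) Φ(x+e_μ) U(x,μ)ᴴ` (GPGAO's `Γ_μ(n)A(n+μ̂)Γ_μ(n)†`), its adjoint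
  `covShiftAdj` (through the inverse shift), the forward covariant difference `covDeriv = covShift − id` (`∇⁺_μ`) and the
  (minus backward) covariant divergence `covDiv U a = Σ_μ (covShiftAdj U μ (a μ) − a μ)`; isometry (`sum_hsRe_covShift`),
  adjointness (`sum_hsRe_covShiftAdj`), two-sided inverses; ★ at a PHASE-FLAT background (`IsPhaseFlat U`: every plaquette of
  `U` is a phase times `1` — e.g. every twist-eating ladder of `…TwistedSlabVacuumOrbits`) the covariant shifts COMMUTE
  (`covShift_comm`) and satisfy the mixed relation `covShift μ ∘ covShiftAdj ν = covShiftAdj ν ∘ covShift μ` (`covShift_covShiftAdj_comm`) —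
  hypothesis `(H)` of lit-4's abstract `Literature.Analysis.OperatorTheory.DiscreteWeitzenboeckIdentity` («the `∇⁺_μ` commute»);
The Weitzenböck identity and the Coulomb-gauge transfer of a 0-form gap (`…TwistedSlabWeitzenboeck`), the 0-form gap at the
twist-eating ladder (`4 sin²(π/(Nℓ₀))`, lit-4's `twistedTorus_poincare_sharp`; `…TwistedSlabZeroFormGap`) and the identification of the
curl form with the second variation of the T1 integrand's exponent (`…TwistedSlabHessian`) are the next files.

HONEST FRAMING: finite-dimensional operator algebra on one box — TREE LEVEL; nothing here is an estimate on the Wilson measure,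
nothing uniform in `β`; T1-box 0∕1, T1 proper (uniform exponential vacuum dominance) 0∕1; nothing bears on `IRcof`, `IR`, or the
Yang–Mills mass gap (Clay: NOT proved); R4 = `BalabanLadder.UV` only.  References: M. García Pérez, A. González-Arroyo, M. Okawa,
JHEP 10 (2017) 150 §2.3, §2.5 (covariant differences `∇⁺_μ`, their commutation at a zero-action background, Feynman gauge);
I. Montvay, G. Münster, *Quantum Fields on a Lattice* §3.2.5 (lattice covariant derivative, background field).
-/

set_option autoImplicit false

noncomputable section

open scoped Matrix
open Finset
open Literature.MathematicalPhysics.QuantumFieldTheory Literature.MathematicalPhysics.QuantumLattice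

namespace Summit.QuantumFields.YangMills.Cruxes.IRcof.TwistedSlab

variable {N : ℕ} {n₀ n₁ n₂ n₃ : ℕ}

/-! ## §1 The polarised Hilbert–Schmidt pairing `Re tr(XᴴY)` -/

section Pairing

/-- Symmetry `Re tr(XᴴY) = Re tr(YᴴX)` (also landed, in another currency chain, as
`Prop7CovariantCoercivity.re_trace_conjTranspose_mul_comm`; kept private here to avoid importing the Bałaban cone). [folklore] -/
private theorem hsRe_symm (X Y : Matrix (Fin N) (Fin N) ℂ) : ((Xᴴ * Y).trace).re = ((Yᴴ * X).trace).re := by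
  have h : Yᴴ * X = (Xᴴ * Y)ᴴ := by rw [Matrix.conjTranspose_mul, Matrix.conjTranspose_conjTranspose]
  rw [h, Matrix.trace_conjTranspose, Complex.star_def, Complex.conj_re]

/-- Left subtraction: `Re tr((X − Y)ᴴZ) = Re tr(XᴴZ) − Re tr(YᴴZ)`. [folklore] -/
theorem hsRe_sub_left (X Y Z : Matrix (Fin N) (Fin N) ℂ) :
    (((X - Y)ᴴ * Z).trace).re = ((Xᴴ * Z).trace).re - ((Yᴴ * Z).trace).re := by
  rw [Matrix.conjTranspose_sub, Matrix.sub_mul, Matrix.trace_sub, Complex.sub_re]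

/-- Right subtraction: `Re tr(Xᴴ(Y − Z)) = Re tr(XᴴY) − Re tr(XᴴZ)`. [folklore] -/
theorem hsRe_sub_right (X Y Z : Matrix (Fin N) (Fin N) ℂ) :
    ((Xᴴ * (Y - Z)).trace).re = ((Xᴴ * Y).trace).re - ((Xᴴ * Z).trace).re := by
  rw [Matrix.mul_sub, Matrix.trace_sub, Complex.sub_re]

/-- `S(X − Y) = S(X) + S(Y) − 2 Re tr(XᴴY)`. [folklore] -/
theorem hsS_sub (X Y : Matrix (Fin N) (Fin N) ℂ) :
    (((X - Y)ᴴ * (X - Y)).trace).re =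
      ((Xᴴ * X).trace).re + ((Yᴴ * Y).trace).re - 2 * ((Xᴴ * Y).trace).re := by
  rw [hsRe_sub_left, hsRe_sub_right, hsRe_sub_right, hsRe_symm Y X]
  ring

/-- `S(X + Y) = S(X) + S(Y) + 2 Re tr(XᴴY)`. [folklore] -/
theorem hsS_add (X Y : Matrix (Fin N) (Fin N) ℂ) :
    (((X + Y)ᴴ * (X + Y)).trace).re =
      ((Xᴴ * X).trace).re + ((Yᴴ * Y).trace).re + 2 * ((Xᴴ * Y).trace).re := by
  rw [Matrix.conjTranspose_add, Matrix.add_mul, Matrix.mul_add, Matrix.mul_add, Matrix.trace_add, Matrix.trace_add,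
    Matrix.trace_add, Complex.add_re, Complex.add_re, Complex.add_re, hsRe_symm Y X]
  ring

/-- `S(−X) = S(X)`. [folklore] -/
theorem hsS_neg (X : Matrix (Fin N) (Fin N) ℂ) : (((-X)ᴴ * (-X)).trace).re = ((Xᴴ * X).trace).re := by
  rw [Matrix.conjTranspose_neg, Matrix.neg_mul, Matrix.mul_neg, neg_neg]

/-- `Ad V` is an isometry of the pairing: `Re tr((VXVᴴ)ᴴ(VYVᴴ)) = Re tr(XᴴY)` for `VᴴV = 1`. [folklore] -/
theorem hsRe_conj {V : Matrix (Fin N) (Fin N) ℂ} (hV : Vᴴ * V = 1) (X Y : Matrix (Fin N) (Fin N) ℂ) :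
    (((V * X * Vᴴ)ᴴ * (V * Y * Vᴴ)).trace).re = ((Xᴴ * Y).trace).re := by
  have hm : (V * X * Vᴴ)ᴴ * (V * Y * Vᴴ) = V * (Xᴴ * Y * Vᴴ) := by
    rw [Matrix.conjTranspose_mul, Matrix.conjTranspose_mul, Matrix.conjTranspose_conjTranspose]
    calc V * (Xᴴ * Vᴴ) * (V * Y * Vᴴ) = V * (Xᴴ * (Vᴴ * V) * Y) * Vᴴ := by simp only [Matrix.mul_assoc]
      _ = V * (Xᴴ * Y) * Vᴴ := by rw [hV, Matrix.mul_one]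
      _ = V * (Xᴴ * Y * Vᴴ) := by rw [Matrix.mul_assoc]
  rw [hm, Matrix.trace_mul_comm, Matrix.mul_assoc, hV, Matrix.mul_one]

/-- The opposite conjugation `X ↦ VᴴXV` is an isometry as well (`VVᴴ = 1`). [folklore] -/
theorem hsRe_conj' {V : Matrix (Fin N) (Fin N) ℂ} (hV : V * Vᴴ = 1) (X Y : Matrix (Fin N) (Fin N) ℂ) :
    (((Vᴴ * X * V)ᴴ * (Vᴴ * Y * V)).trace).re = ((Xᴴ * Y).trace).re := by
  have h := hsRe_conj (V := Vᴴ) (by rwa [Matrix.conjTranspose_conjTranspose]) X Y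
  rwa [Matrix.conjTranspose_conjTranspose] at h

end Pairing

/-! ## §2 The periodic shift as a bijection of the sites; summation by parts = reindexing -/

section Shifts

/-- The site `x − e_μ` (inverse periodic shift: `finRotate⁻¹` in the `μ`-th coordinate). [folklore] -/
def siteUnshift (x : FinTorusSite n₀ n₁ n₂ n₃) (μ : Fin 4) : FinTorusSite n₀ n₁ n₂ n₃ :=
  ![((finRotate n₀).symm x.1, x.2.1, x.2.2.1, x.2.2.2), (x.1, (finRotate n₁).symm x.2.1, x.2.2.1, x.2.2.2),
    (x.1, x.2.1, (finRotate n₂).symm x.2.2.1, x.2.2.2), (x.1, x.2.1, x.2.2.1, (finRotate n₃).symm x.2.2.2)] μ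

/-- `(x + e_μ) − e_μ = x`. [folklore] -/
@[simp] theorem siteUnshift_shift (x : FinTorusSite n₀ n₁ n₂ n₃) (μ : Fin 4) : siteUnshift (x.shift μ) μ = x := by
  obtain ⟨a, b, c, d⟩ := x
  fin_cases μ <;> simp [FinTorusSite.shift, siteUnshift, -finRotate_apply, -finRotate_symm_apply]

/-- `(x − e_μ) + e_μ = x`. [folklore] -/
@[simp] theorem shift_siteUnshift (x : FinTorusSite n₀ n₁ n₂ n₃) (μ : Fin 4) : (siteUnshift x μ).shift μ = x := by
  obtain ⟨a, b, c, d⟩ := x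
  fin_cases μ <;> simp [FinTorusSite.shift, siteUnshift, -finRotate_apply, -finRotate_symm_apply]

/-- **The periodic shift in direction `μ` is a bijection of the sites.** [folklore] -/
def shiftEquiv (n₀ n₁ n₂ n₃ : ℕ) (μ : Fin 4) : FinTorusSite n₀ n₁ n₂ n₃ ≃ FinTorusSite n₀ n₁ n₂ n₃ where
  toFun x := x.shift μ
  invFun x := siteUnshift x μ
  left_inv x := siteUnshift_shift x μ
  right_inv x := shift_siteUnshift x μ

/-- Unfolding lemma. [folklore] -/
@[simp] theorem shiftEquiv_apply (μ : Fin 4) (x : FinTorusSite n₀ n₁ n₂ n₃) : shiftEquiv n₀ n₁ n₂ n₃ μ x = x.shift μ := rfl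

/-- **Summation by parts on the `Fin` torus**: `Σ_x f(x + e_μ) = Σ_x f(x)`. [folklore] -/
theorem sum_shift {M : Type*} [AddCommMonoid M] (f : FinTorusSite n₀ n₁ n₂ n₃ → M) (μ : Fin 4) :
    ∑ x : FinTorusSite n₀ n₁ n₂ n₃, f (x.shift μ) = ∑ x, f x :=
  (shiftEquiv n₀ n₁ n₂ n₃ μ).sum_comp f

/-- `Σ_x f(x − e_μ) = Σ_x f(x)`. [folklore] -/
theorem sum_unshift {M : Type*} [AddCommMonoid M] (f : FinTorusSite n₀ n₁ n₂ n₃ → M) (μ : Fin 4) :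
    ∑ x : FinTorusSite n₀ n₁ n₂ n₃, f (siteUnshift x μ) = ∑ x, f x :=
  (shiftEquiv n₀ n₁ n₂ n₃ μ).symm.sum_comp f

end Shifts

/-! ## §3 Adjoint covariant shifts with respect to a unitary background link field -/

section Covariant

variable (U : FinTorusSite n₀ n₁ n₂ n₃ × Fin 4 → Matrix (Fin N) (Fin N) ℂ)

/-- **The adjoint covariant shift** of a site field along direction `μ` with respect to the background link field `U`:
`(S_μ Φ)(x) = U(x,μ) · Φ(x + e_μ) · U(x,μ)ᴴ` (parallel transport of `Φ(x+μ̂)` back to `x` in the adjoint representation).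
[folklore; García Pérez–González-Arroyo–Okawa 2017 §2.3: `A'_ν(n+μ̂) = Γ_μ(n) A_ν(n+μ̂) Γ_μ(n)†`] -/
def covShift (μ : Fin 4) (Φ : FinTorusSite n₀ n₁ n₂ n₃ → Matrix (Fin N) (Fin N) ℂ) :
    FinTorusSite n₀ n₁ n₂ n₃ → Matrix (Fin N) (Fin N) ℂ :=
  fun x => U (x, μ) * Φ (x.shift μ) * (U (x, μ))ᴴ

/-- **The adjoint of the covariant shift**: `(S_μ† Ψ)(x) = U(x−e_μ,μ)ᴴ · Ψ(x − e_μ) · U(x−e_μ,μ)`. [folklore] -/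
def covShiftAdj (μ : Fin 4) (Ψ : FinTorusSite n₀ n₁ n₂ n₃ → Matrix (Fin N) (Fin N) ℂ) :
    FinTorusSite n₀ n₁ n₂ n₃ → Matrix (Fin N) (Fin N) ℂ :=
  fun x => (U (siteUnshift x μ, μ))ᴴ * Ψ (siteUnshift x μ) * U (siteUnshift x μ, μ)

/-- **The forward covariant difference** `∇⁺_μ Φ = S_μ Φ − Φ` (the linearised adjoint covariant derivative at the background).
[folklore; García Pérez–González-Arroyo–Okawa 2017 §2.3 (2.3): `∇⁺_μ A_ν(n) = Γ_μ A_ν(n+μ̂) Γ_μ† − A_ν(n)`] -/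
def covDeriv (μ : Fin 4) (Φ : FinTorusSite n₀ n₁ n₂ n₃ → Matrix (Fin N) (Fin N) ℂ) :
    FinTorusSite n₀ n₁ n₂ n₃ → Matrix (Fin N) (Fin N) ℂ :=
  fun x => covShift U μ Φ x - Φ x

/-- **The covariant divergence** of a lattice 1-form `a` (one site field per direction): `div a = Σ_μ (S_μ† a_μ − a_μ)` —
minus the backward covariant divergence `∇⁻·a`, the background-field gauge-fixing function (Coulomb ∕ Lorenz slice `div a = 0`).
[folklore; García Pérez–González-Arroyo–Okawa 2017 §2.5 (`S_GF = ξ⁻¹ Σ Tr(∇⁻_μ A_μ)²`)] -/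
def covDiv (a : Fin 4 → FinTorusSite n₀ n₁ n₂ n₃ → Matrix (Fin N) (Fin N) ℂ) :
    FinTorusSite n₀ n₁ n₂ n₃ → Matrix (Fin N) (Fin N) ℂ :=
  fun x => ∑ μ, (covShiftAdj U μ (a μ) x - a μ x)

variable {U}

/-- Unfolding lemma. [folklore] -/
theorem covShift_apply (μ : Fin 4) (Φ : FinTorusSite n₀ n₁ n₂ n₃ → Matrix (Fin N) (Fin N) ℂ) (x : FinTorusSite n₀ n₁ n₂ n₃) :
    covShift U μ Φ x = U (x, μ) * Φ (x.shift μ) * (U (x, μ))ᴴ := rfl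

/-- Unfolding lemma. [folklore] -/
theorem covDeriv_apply (μ : Fin 4) (Φ : FinTorusSite n₀ n₁ n₂ n₃ → Matrix (Fin N) (Fin N) ℂ) (x : FinTorusSite n₀ n₁ n₂ n₃) :
    covDeriv U μ Φ x = U (x, μ) * Φ (x.shift μ) * (U (x, μ))ᴴ - Φ x := rfl

/-- The covariant shift is additive. [folklore] -/
theorem covShift_sub (μ : Fin 4) (Φ Ψ : FinTorusSite n₀ n₁ n₂ n₃ → Matrix (Fin N) (Fin N) ℂ) :
    covShift U μ (fun x => Φ x - Ψ x) = fun x => covShift U μ Φ x - covShift U μ Ψ x := by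
  funext x; simp only [covShift, Matrix.mul_sub, Matrix.sub_mul]

/-- The adjoint covariant shift is additive. [folklore] -/
theorem covShiftAdj_sub (μ : Fin 4) (Φ Ψ : FinTorusSite n₀ n₁ n₂ n₃ → Matrix (Fin N) (Fin N) ℂ) :
    covShiftAdj U μ (fun x => Φ x - Ψ x) = fun x => covShiftAdj U μ Φ x - covShiftAdj U μ Ψ x := by
  funext x; simp only [covShiftAdj, Matrix.mul_sub, Matrix.sub_mul]

/-- Covariant shifts preserve the trace (conjugation by a unitary). [folklore] -/
theorem trace_covShift (hU : ∀ e, U e ∈ Matrix.unitaryGroup (Fin N) ℂ) (μ : Fin 4)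
    (Φ : FinTorusSite n₀ n₁ n₂ n₃ → Matrix (Fin N) (Fin N) ℂ) (x : FinTorusSite n₀ n₁ n₂ n₃) :
    (covShift U μ Φ x).trace = (Φ (x.shift μ)).trace := by
  have h1 : (U (x, μ))ᴴ * U (x, μ) = 1 := (hU (x, μ)).1
  rw [covShift_apply, Matrix.trace_mul_cycle, h1, Matrix.one_mul]

section Unitary

variable (hU : ∀ e, U e ∈ Matrix.unitaryGroup (Fin N) ℂ)
include hU

/-- `S_μ† (S_μ Φ) = Φ`. [folklore] -/
theorem covShiftAdj_covShift (μ : Fin 4) (Φ : FinTorusSite n₀ n₁ n₂ n₃ → Matrix (Fin N) (Fin N) ℂ) :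
    covShiftAdj U μ (covShift U μ Φ) = Φ := by
  funext x
  have h1 : (U (siteUnshift x μ, μ))ᴴ * U (siteUnshift x μ, μ) = 1 := (hU _).1
  simp only [covShiftAdj, covShift, shift_siteUnshift]
  calc (U (siteUnshift x μ, μ))ᴴ * (U (siteUnshift x μ, μ) * Φ x * (U (siteUnshift x μ, μ))ᴴ) * U (siteUnshift x μ, μ)
      = ((U (siteUnshift x μ, μ))ᴴ * U (siteUnshift x μ, μ)) * Φ x * ((U (siteUnshift x μ, μ))ᴴ * U (siteUnshift x μ, μ)) := by
        simp only [Matrix.mul_assoc]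
    _ = Φ x := by rw [h1, Matrix.one_mul, Matrix.mul_one]

/-- `S_μ (S_μ† Ψ) = Ψ`. [folklore] -/
theorem covShift_covShiftAdj (μ : Fin 4) (Ψ : FinTorusSite n₀ n₁ n₂ n₃ → Matrix (Fin N) (Fin N) ℂ) :
    covShift U μ (covShiftAdj U μ Ψ) = Ψ := by
  funext x
  have h2 : U (x, μ) * (U (x, μ))ᴴ = 1 := (hU _).2
  simp only [covShiftAdj, covShift, siteUnshift_shift]
  calc U (x, μ) * ((U (x, μ))ᴴ * Ψ x * U (x, μ)) * (U (x, μ))ᴴ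
      = (U (x, μ) * (U (x, μ))ᴴ) * Ψ x * (U (x, μ) * (U (x, μ))ᴴ) := by simp only [Matrix.mul_assoc]
    _ = Ψ x := by rw [h2, Matrix.one_mul, Matrix.mul_one]

/-- **Isometry**: `Σ_x Re tr((S_μΦ)(x)ᴴ (S_μΨ)(x)) = Σ_x Re tr(Φ(x)ᴴΨ(x))` (unitary conjugation, then reindexing along the shift).
[folklore] -/
theorem sum_hsRe_covShift (μ : Fin 4) (Φ Ψ : FinTorusSite n₀ n₁ n₂ n₃ → Matrix (Fin N) (Fin N) ℂ) :
    ∑ x, (((covShift U μ Φ x)ᴴ * covShift U μ Ψ x).trace).re = ∑ x, (((Φ x)ᴴ * Ψ x).trace).re := by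
  calc ∑ x, (((covShift U μ Φ x)ᴴ * covShift U μ Ψ x).trace).re
      = ∑ x, (((Φ (x.shift μ))ᴴ * Ψ (x.shift μ)).trace).re :=
        Finset.sum_congr rfl fun x _ => by
          have h1 : (U (x, μ))ᴴ * U (x, μ) = 1 := (hU (x, μ)).1
          rw [covShift_apply, covShift_apply]
          exact hsRe_conj h1 _ _
    _ = ∑ x, (((Φ x)ᴴ * Ψ x).trace).re := sum_shift (fun x => (((Φ x)ᴴ * Ψ x).trace).re) μ

/-- The covariant shift preserves the Hilbert–Schmidt energy `Σ_x S(Φ x)`. [folklore] -/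
theorem sum_hsS_covShift (μ : Fin 4) (Φ : FinTorusSite n₀ n₁ n₂ n₃ → Matrix (Fin N) (Fin N) ℂ) :
    ∑ x, (((covShift U μ Φ x)ᴴ * covShift U μ Φ x).trace).re = ∑ x, (((Φ x)ᴴ * Φ x).trace).re :=
  sum_hsRe_covShift hU μ Φ Φ

/-- **Adjointness**: `Σ_x Re tr((S_μ†Ψ)(x)ᴴ Φ(x)) = Σ_x Re tr(Ψ(x)ᴴ (S_μΦ)(x))`. [folklore] -/
theorem sum_hsRe_covShiftAdj (μ : Fin 4) (Ψ Φ : FinTorusSite n₀ n₁ n₂ n₃ → Matrix (Fin N) (Fin N) ℂ) :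
    ∑ x, (((covShiftAdj U μ Ψ x)ᴴ * Φ x).trace).re = ∑ x, (((Ψ x)ᴴ * covShift U μ Φ x).trace).re := by
  have h := sum_hsRe_covShift hU μ (covShiftAdj U μ Ψ) Φ
  rw [covShift_covShiftAdj hU] at h
  exact h.symm

/-- Adjointness for the covariant differences: `Σ_x Re tr((S_μ†Ψ − Ψ)(x)ᴴ Φ(x)) = Σ_x Re tr(Ψ(x)ᴴ (∇⁺_μΦ)(x))`. [folklore] -/
theorem sum_hsRe_covDerivAdj (μ : Fin 4) (Ψ Φ : FinTorusSite n₀ n₁ n₂ n₃ → Matrix (Fin N) (Fin N) ℂ) :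
    ∑ x, (((covShiftAdj U μ Ψ x - Ψ x)ᴴ * Φ x).trace).re = ∑ x, (((Ψ x)ᴴ * covDeriv U μ Φ x).trace).re := by
  simp only [covDeriv, hsRe_sub_left, hsRe_sub_right, Finset.sum_sub_distrib, sum_hsRe_covShiftAdj hU]

end Unitary

/-- **Phase-flat background**: every plaquette of `U` is a phase — `U(x,μ)U(x+e_μ,ν) = c·U(x,ν)U(x+e_ν,μ)` with `|c| = 1`
(the plaquette holonomy is the central unitary `c·1`).  Every twist-eating ladder (zero-action configuration of a twisted box)
is phase-flat; so is every flat configuration. [folklore; García Pérez–González-Arroyo–Okawa 2017 §2.2] -/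
def IsPhaseFlat (U : FinTorusSite n₀ n₁ n₂ n₃ × Fin 4 → Matrix (Fin N) (Fin N) ℂ) : Prop :=
  ∀ (x : FinTorusSite n₀ n₁ n₂ n₃) (μ ν : Fin 4), ∃ c : ℂ, star c * c = 1 ∧
    U (x, μ) * U (x.shift μ, ν) = c • (U (x, ν) * U (x.shift ν, μ))

/-- ★ **At a phase-flat background the adjoint covariant shifts commute**: `S_μ S_ν = S_ν S_μ` (the plaquette phase cancels in
the adjoint representation). [folklore; García Pérez–González-Arroyo–Okawa 2017 §2.3 («notice that they commute»)] -/
theorem covShift_comm (hflat : IsPhaseFlat U) (μ ν : Fin 4) (Φ : FinTorusSite n₀ n₁ n₂ n₃ → Matrix (Fin N) (Fin N) ℂ) :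
    covShift U μ (covShift U ν Φ) = covShift U ν (covShift U μ Φ) := by
  funext x
  obtain ⟨c, hc, hV⟩ := hflat x μ ν
  have hc' : c * star c = 1 := by rw [mul_comm]; exact hc
  simp only [covShift]
  rw [FinTorusSite.shift_comm x μ ν]
  set P := Φ ((x.shift ν).shift μ)
  calc U (x, μ) * (U (x.shift μ, ν) * P * (U (x.shift μ, ν))ᴴ) * (U (x, μ))ᴴ
      = (U (x, μ) * U (x.shift μ, ν)) * P * (U (x, μ) * U (x.shift μ, ν))ᴴ := by
        rw [Matrix.conjTranspose_mul]; simp only [Matrix.mul_assoc]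
    _ = (c • (U (x, ν) * U (x.shift ν, μ))) * P * (c • (U (x, ν) * U (x.shift ν, μ)))ᴴ := by rw [hV]
    _ = (U (x, ν) * U (x.shift ν, μ)) * P * (U (x, ν) * U (x.shift ν, μ))ᴴ := by
        rw [Matrix.conjTranspose_smul, Matrix.smul_mul, Matrix.smul_mul, Matrix.mul_smul, smul_smul, hc', one_smul]
    _ = U (x, ν) * (U (x.shift ν, μ) * P * (U (x.shift ν, μ))ᴴ) * (U (x, ν))ᴴ := by
        rw [Matrix.conjTranspose_mul]; simp only [Matrix.mul_assoc]

/-- ★ **The mixed relation `S_μ S_ν† = S_ν† S_μ`** at a phase-flat unitary background — hypothesis `(H)` of the abstract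
Weitzenböck identity (`DiscreteWeitzenboeck.of_commuting_unitaries`, here on the nose). [folklore] -/
theorem covShift_covShiftAdj_comm (hU : ∀ e, U e ∈ Matrix.unitaryGroup (Fin N) ℂ) (hflat : IsPhaseFlat U) (μ ν : Fin 4)
    (Ψ : FinTorusSite n₀ n₁ n₂ n₃ → Matrix (Fin N) (Fin N) ℂ) :
    covShift U μ (covShiftAdj U ν Ψ) = covShiftAdj U ν (covShift U μ Ψ) := by
  calc covShift U μ (covShiftAdj U ν Ψ)
      = covShiftAdj U ν (covShift U ν (covShift U μ (covShiftAdj U ν Ψ))) := (covShiftAdj_covShift hU ν _).symm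
    _ = covShiftAdj U ν (covShift U μ (covShift U ν (covShiftAdj U ν Ψ))) := by rw [covShift_comm hflat]
    _ = covShiftAdj U ν (covShift U μ Ψ) := by rw [covShift_covShiftAdj hU]

/-- `(H)` for the covariant differences: `∇⁺_μ (S_ν† − 1) = (S_ν† − 1) ∇⁺_μ`. [folklore] -/
theorem covDeriv_covDerivAdj_comm (hU : ∀ e, U e ∈ Matrix.unitaryGroup (Fin N) ℂ) (hflat : IsPhaseFlat U) (μ ν : Fin 4)
    (Ψ : FinTorusSite n₀ n₁ n₂ n₃ → Matrix (Fin N) (Fin N) ℂ) :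
    covDeriv U μ (fun x => covShiftAdj U ν Ψ x - Ψ x) =
      fun x => covShiftAdj U ν (covDeriv U μ Ψ) x - covDeriv U μ Ψ x := by
  funext x
  have hx := congrFun (covShift_covShiftAdj_comm hU hflat μ ν Ψ) x
  have e1 : covShift U μ (fun y => covShiftAdj U ν Ψ y - Ψ y) x =
      covShift U μ (covShiftAdj U ν Ψ) x - covShift U μ Ψ x :=
    congrFun (covShift_sub μ (covShiftAdj U ν Ψ) Ψ) x
  have e2 : covShiftAdj U ν (covDeriv U μ Ψ) x = covShiftAdj U ν (covShift U μ Ψ) x - covShiftAdj U ν Ψ x :=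
    congrFun (covShiftAdj_sub ν (covShift U μ Ψ) Ψ) x
  show covShift U μ (fun y => covShiftAdj U ν Ψ y - Ψ y) x - (covShiftAdj U ν Ψ x - Ψ x) =
    covShiftAdj U ν (covDeriv U μ Ψ) x - (covShift U μ Ψ x - Ψ x)
  rw [e1, e2, hx]
  abel

end Covariant

end Summit.QuantumFields.YangMills.Cruxes.IRcof.TwistedSlab

end
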